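import Literature.AnabelianGeometry.AbsoluteAnabelian.AbsTopIII.GeometricCyclotomeModule
import HarnessLib

/-!
# [AbsTopIII] Thm. 1.9 (b): the synchronizations `I_z ⥲ μ_Ẑ(Π_U) := M_Z` (typed statement)

Mochizuki, *Topics in Absolute Anabelian Geometry III*, §1, Thm. 1.9 (b), manuscript p. 37 (lit key
`paper:url-5493eb38cbb7`): "One constructs the natural isomorphisms `I_z ⥲ μ_Ẑ(Π_U) := M_Z` — where
`U ⊆ Y → X` is as in (a) [author's comments (Jun 2019), item (6): '(i)' → '(a)'], `Y` is of genus
`≥ 2`, `Z` is the canonical compactification of `Y`, the points of `Z ∖ U` are all rational over the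
base field `k_Z` of `Z`, `z ∈ (Z ∖ U)(k_Z)` — via the technique of Proposition 1.4, (ii)."

Both sides are REAL objects of the tree: the cuspidal inertia groups `I_z` of the interface
(`FundamentalExtension.CuspidalData`) and the intrinsic geometric cyclotome
`M_Z = Hom(H²(Δ_Z, Ẑ), Ẑ)` with its `Π_Z`-action (`CyclotomeMod`, `cyclotomeModRep`,
`GeometricCyclotome(Module).lean`).  The statement is typed RELATIVE TO A MODEL `M : CurveModel`
(typing policy θ of the abc-iut cell) and asserts only the EXISTENCE of a `D_z`-equivariant
isomorphism — the NATURAL isomorphism of the text (Leray differential of Prop. 1.4 (ii)) is not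
singled out (recorded limitation; it is what the subgroup `P_U` of Thm. 1.9 (c) would need).
HONEST FRAMING: typed ≠ discharged; nothing here bears on [IUTchIII] Cor. 3.12.
-/

noncomputable section

universe u

namespace Literature.AnabelianGeometry.AbsoluteAnabelian

namespace AbsTopIII

/-- `D_z` normalizes `I_z = D_z ∩ Δ`: conjugates of inertia elements by decomposition elements are
inertia elements. [cite: MochizukiAbsTopIII2015, Prop 1.4 (i) p.31] -/
theorem _root_.Literature.AnabelianGeometry.AbsoluteAnabelian.FundamentalExtension.CuspidalData.conj_mem_Icusp
    {E : FundamentalExtension.{u}} (C : E.CuspidalData) (z : C.Cusp) {d i : E.arith}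
    (hd : d ∈ C.Dcusp z) (hi : i ∈ C.Icusp z) : d * i * d⁻¹ ∈ C.Icusp z := by
  rw [C.Icusp_eq] at hi ⊢
  exact ⟨(C.Dcusp z).mul_mem ((C.Dcusp z).mul_mem hd hi.1) ((C.Dcusp z).inv_mem hd),
    E.normal_geom.conj_mem i hi.2 d⟩

namespace CurveModel

/-- **Thm. 1.9 (b), relative to `M`** ("one constructs the natural isomorphisms
`I_z ⥲ μ_Ẑ(Π_U) := M_Z` [...] `Z` is the canonical compactification [...] `z ∈ (Z ∖ U)(k_Z)` — via the
technique of Proposition 1.4, (ii)", p. 37): for a cofinite open `U ⊆ Z` of the model with `Z` a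
PROPER scheme-like curve of genus `≥ 2` such that — print hypothesis — "the points of `Z ∖ U` are
all rational over the base field `k_Z` of `Z`" (every cusp of `U` is rational), and a cusp `z` of `U`
with free procyclic inertia, there is an isomorphism `I_z ≅ M_Z = Hom(H²(Δ_Z, Ẑ), Ẑ)` (`CyclotomeMod`,
coefficients `Ẑ = ZHatCoeff`) equivariant for the decomposition group `D_z` (acting on `I_z` by
conjugation and on `M_Z` through `Π_U ↠ Π_Z` and `cyclotomeModRep`).  Existence only; NAMED FACT
relative to `M`.  (The per-cusp variant assuming only `z` rational is derivable — enlarge `U` to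
`Z ∖ {z}` and transport `I_z` by Prop. 1.4 (i) — but is not what the text states, so it is not the
typed form; referee L7-F4.)
-- TODO(general form): the text allows an intermediate finite étale cover `U ⊆ Y → X`; `CurveModel`
has no covering relation, so the statement is typed for `Y = X`-type presentations `U ⊆ Z`.
[cite: MochizukiAbsTopIII2015, Thm 1.9 (b) p.37] -/
def Thm_1_9_b (M : CurveModel.{u}) : Prop :=
  ∀ (U Z : M.Curve) (h : M.IsCofiniteOpen U Z), M.IsScheme U → M.IsScheme Z → M.IsProper Z →
    2 ≤ M.genus Z → (∀ c : (M.cusps U).Cusp, (M.cusps U).IsRational c) →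
      ∀ z : (M.cusps U).Cusp, FundamentalExtension.IsFreeProcyclic ((M.cusps U).Icusp z) →
        ∃ φ : Additive ((M.cusps U).Icusp z) ≃+ CyclotomeMod (M.ext Z) ZHatCoeff.{u},
          ∀ (d : (M.ext U).arith) (hd : d ∈ (M.cusps U).Dcusp z) (i : (M.cusps U).Icusp z),
            φ (Additive.ofMul ⟨d * i * d⁻¹, (M.cusps U).conj_mem_Icusp z hd i.2⟩) =
              cyclotomeModRep (M.ext Z) ZHatCoeff.{u} ((M.res h).arith d) (φ (Additive.ofMul i))

end CurveModel

end AbsTopIII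

end Literature.AnabelianGeometry.AbsoluteAnabelian
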